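import Literature.NumberTheory.LFunctions.RobinCriterionCLMS
import HarnessLib

/-!
# RH-EQUIVALENT — Robin's inequality on the Hardy–Ramanujan integers (CLMS 2007, §5 Prop. 1; Broughan vol. 1, §8.2)

RH-EQUIVALENT (a proved reduction of Robin's criterion to a sparse set of integers); nothing here
bears on the truth of RH. Literature-typing tranche 1 (Broughan, *Equivalents of the Riemann
Hypothesis* vol. 1, Ch. 8 "Numbers that do not satisfy Robin's inequality", §8.2 "Hardy–Ramanujan
numbers", pp. 202–207), from the primary source Choie–Lichiardopol–Moree–Solé 2007, §5.

A **Hardy–Ramanujan integer** is an integer `∏_{i=1}^{s} p_i^{e_i}` (`p_1 = 2 < p_2 = 3 < …` the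
consecutive primes) with `e_1 ≥ e_2 ≥ ⋯ ≥ e_s ≥ 0` (CLMS §5; `IsHardyRamanujan`: the exponent of a
larger prime never exceeds that of a smaller one). **CLMS Prop. 1 (PROVED, RH-free)**: "If Robin's
inequality holds for all Hardy–Ramanujan integers `5041 ≤ n ≤ x`, then it holds for all integers
`5041 ≤ n ≤ x`" (`CLMS2007_prop1`). Hence (with Robin's criterion `robin_iff`) the
**equivalence of §8.2 (PROVED)**: RH `⟺` Robin's inequality `σ(n) < e^γ n log log n` holds for every
Hardy–Ramanujan integer `n > 5040` (`riemannHypothesis_iff_robin_hardyRamanujan_of (hR : robin_iff)`,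
kernel-grade; `riemannHypothesis_iff_robin_hardyRamanujan`, unconditional via `robin_iff_holds`,
which carries a computational closure).

## The proof of Prop. 1 (CLMS Lemmas 7–10, streamlined)

CLMS show that among the integers with a given exponent pattern `ē` the quotient `σ(n)/n` is
largest at the Hardy–Ramanujan integer `m(ē)`, the least of them (Lemmas 7–9), whence Lemma 10 and
Prop. 1. We prove the exchange step in the one-prime-at-a-time form, which needs no calculus
(`sigma_exchange_lt`): if `p < q` are primes and `p^e ∥ n`, `q^f ∥ n` with `e < f`, then
`n' = n·p/q < n` has `σ(n)/n < σ(n')/n'` — because `σ(p^{e+1}) σ(q^{f−1}) q − σ(p^e) σ(q^f) p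
= q σ(q^{f−1}) − p σ(p^e) > 0`. Iterating (strong induction on `n`, `exists_hardyRamanujan_le`): every
`n ≥ 1` admits a Hardy–Ramanujan `m ≤ n` with `σ(n)/n ≤ σ(m)/m`. Then for `5040 < n ≤ x`: if
`m > 5040`, Robin at `m` (hypothesis) and `log log m ≤ log log n` give Robin at `n` (CLMS Lemma 10 (2));
if `m ≤ 5040` — the case the printed proof leaves to the reader — either `n ≤ 55440` and Robin at `n` is
the tree's certified computation `robinInequality_le_55440`, or `n > 55440` and
`σ(n)/n ≤ σ(m)/m ≤ 4.2518 < e^γ log log 54000` by the tree's Robin certificate `RobinCheck.check` run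
over `1 ≤ m ≤ 5040` (`checkRange_one_5040`, kernel) and `RobinCheck.robinInequality_of_bound`.

## References

* Y. Choie, N. Lichiardopol, P. Moree, P. Solé, *On Robin's criterion for the Riemann hypothesis*,
  J. Théor. Nombres Bordeaux 19 (2007), 357–372, §5: definition of Hardy–Ramanujan integers,
  Prop. 1, Lemmas 7–10 [corpus:paper:arxiv-math-0604314 p0008–p0009]. [CLMS2007]
* G. Robin, J. Math. Pures Appl. 63 (1984), 187–213, Thm. 1. [Robin1984]
* K. Broughan, *Equivalents of the Riemann Hypothesis. Vol. 1*, CUP 2017, §8.2 (pp. 202–207).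
  [Broughan2017Arithmetic]
-/

noncomputable section

open Real Finset
open scoped ArithmeticFunction.sigma

namespace Literature.NumberTheory.LFunctions

/-! ### Hardy–Ramanujan integers -/

/-- A **Hardy–Ramanujan integer**: a positive integer `∏ p_i^{e_i}` over the consecutive primes
`p_1 = 2 < p_2 < ⋯` whose exponents are non-increasing, `e_1 ≥ e_2 ≥ ⋯ ≥ 0`; equivalently, for
primes `p < q` the exponent of `q` in `n` is at most that of `p`. [cite: CLMS2007, §5 (definition)] -/
def IsHardyRamanujan (n : ℕ) : Prop :=
  n ≠ 0 ∧ ∀ p q : ℕ, p.Prime → q.Prime → p < q → n.factorization q ≤ n.factorization p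

/-- Unfolding lemma. [cite: CLMS2007, §5 (definition)] -/
theorem isHardyRamanujan_iff (n : ℕ) : IsHardyRamanujan n ↔
    n ≠ 0 ∧ ∀ p q : ℕ, p.Prime → q.Prime → p < q → n.factorization q ≤ n.factorization p :=
  Iff.rfl

/-- `1` is a Hardy–Ramanujan integer (all exponents `0`). [cite: CLMS2007, §5 (definition)] -/
theorem isHardyRamanujan_one : IsHardyRamanujan 1 :=
  ⟨one_ne_zero, fun p q _ _ _ => by simp⟩

/-- Powers of `2` are Hardy–Ramanujan integers. [cite: CLMS2007, §5 (definition)] -/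
theorem isHardyRamanujan_two_pow (k : ℕ) : IsHardyRamanujan (2 ^ k) := by
  refine ⟨pow_ne_zero _ two_ne_zero, fun p q hp hq hpq => ?_⟩
  have hq2 : q ≠ 2 := by have := hp.two_le; omega
  rw [Nat.Prime.factorization_pow Nat.prime_two, Finsupp.single_apply, if_neg hq2.symm]
  exact Nat.zero_le _

/-! ### The exchange step (CLMS Lemma 8, one prime at a time) -/

/-- `σ(p^e) ≤ σ(q^f)` for `p ≤ q`, `e ≤ f`. [folklore] -/
private theorem sigma_prime_pow_mono {p q e f : ℕ} (hp : p.Prime) (hq : q.Prime) (hpq : p ≤ q)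
    (hef : e ≤ f) : σ 1 (p ^ e) ≤ σ 1 (q ^ f) := by
  rw [ArithmeticFunction.sigma_one_apply_prime_pow hp, ArithmeticFunction.sigma_one_apply_prime_pow hq]
  calc ∑ k ∈ range (e + 1), p ^ k ≤ ∑ k ∈ range (e + 1), q ^ k :=
        Finset.sum_le_sum fun k _ => Nat.pow_le_pow_left hpq k
    _ ≤ ∑ k ∈ range (f + 1), q ^ k :=
        Finset.sum_le_sum_of_subset_of_nonneg (Finset.range_mono (by omega)) fun _ _ _ => Nat.zero_le _

/-- The prime-power core of the exchange: for primes `p < q` and `e ≤ f'`,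
`σ(p^e) σ(q^{f'+1}) p < σ(p^{e+1}) σ(q^{f'}) q`. [cite: CLMS2007, Lemma 8] -/
private theorem sigma_core_lt {p q e f' : ℕ} (hp : p.Prime) (hq : q.Prime) (hpq : p < q)
    (hef : e ≤ f') :
    σ 1 (p ^ e) * σ 1 (q ^ (f' + 1)) * p < σ 1 (p ^ (e + 1)) * σ 1 (q ^ f') * q := by
  rw [RobinCheck.sigma_prime_pow_succ hp, RobinCheck.sigma_prime_pow_succ hq]
  have h1 := sigma_prime_pow_mono hp hq hpq.le hef
  have h2 : 0 < σ 1 (p ^ e) := by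
    rw [ArithmeticFunction.sigma_one_apply_prime_pow hp]
    exact Finset.sum_pos (fun k _ => pow_pos hp.pos k) ⟨0, by simp⟩
  have h3 : p * σ 1 (p ^ e) < q * σ 1 (q ^ f') :=
    lt_of_lt_of_le (Nat.mul_lt_mul_of_pos_right hpq h2) (Nat.mul_le_mul_left _ h1)
  nlinarith

/-- **The exchange step**: if `p < q` are primes, `p ∤ r`, `q ∤ r`, and `e < f`, then moving one
factor `q` to `p` increases `σ(n)/n`: with `n = p^e q^f r`, `n' = p^{e+1} q^{f−1} r` one has
`σ(n)·n' < σ(n')·n`. [cite: CLMS2007, Lemma 8] -/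
theorem sigma_exchange_lt {p q e f r : ℕ} (hp : p.Prime) (hq : q.Prime) (hpq : p < q)
    (hpr : ¬ p ∣ r) (hqr : ¬ q ∣ r) (hr : r ≠ 0) (hef : e < f) :
    σ 1 (p ^ e * (q ^ f * r)) * (p ^ (e + 1) * (q ^ (f - 1) * r)) <
      σ 1 (p ^ (e + 1) * (q ^ (f - 1) * r)) * (p ^ e * (q ^ f * r)) := by
  obtain ⟨f', rfl⟩ : ∃ f', f = f' + 1 := ⟨f - 1, by omega⟩
  simp only [Nat.add_sub_cancel]
  have hpq' : p ≠ q := hpq.ne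
  have hσ := ArithmeticFunction.isMultiplicative_sigma (k := 1)
  -- coprimality
  have hcq : ∀ k, Nat.Coprime (q ^ k) r := fun k =>
    (Nat.Coprime.pow_left k ((Nat.Prime.coprime_iff_not_dvd hq).2 hqr))
  have hcp : ∀ k j, Nat.Coprime (p ^ k) (q ^ j * r) := fun k j =>
    Nat.Coprime.pow_left k (Nat.Coprime.mul_right
      ((Nat.coprime_primes hp hq).2 hpq' |>.pow_right j) ((Nat.Prime.coprime_iff_not_dvd hp).2 hpr))
  rw [hσ.map_mul_of_coprime (hcp e (f' + 1)), hσ.map_mul_of_coprime (hcq (f' + 1)),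
    hσ.map_mul_of_coprime (hcp (e + 1) f'), hσ.map_mul_of_coprime (hcq f')]
  have hcore := sigma_core_lt hp hq hpq (show e ≤ f' by omega)
  have hC : 0 < σ 1 r * r * p ^ e * q ^ f' := by
    have : 0 < σ 1 r := by
      rw [ArithmeticFunction.sigma_one_apply]
      exact Finset.sum_pos (fun d hd => Nat.pos_of_mem_divisors hd) ⟨r, Nat.mem_divisors_self r hr⟩
    have := hp.pos
    have := hq.pos
    positivity
  have e1 : σ 1 (p ^ e) * (σ 1 (q ^ (f' + 1)) * σ 1 r) * (p ^ (e + 1) * (q ^ f' * r)) =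
      (σ 1 (p ^ e) * σ 1 (q ^ (f' + 1)) * p) * (σ 1 r * r * p ^ e * q ^ f') := by ring
  have e2 : σ 1 (p ^ (e + 1)) * (σ 1 (q ^ f') * σ 1 r) * (p ^ e * (q ^ (f' + 1) * r)) =
      (σ 1 (p ^ (e + 1)) * σ 1 (q ^ f') * q) * (σ 1 r * r * p ^ e * q ^ f') := by ring
  rw [e1, e2]
  exact Nat.mul_lt_mul_of_pos_right hcore hC

/-! ### Every `n` is dominated by a Hardy–Ramanujan `m ≤ n` (CLMS Lemma 9) -/

/-- **CLMS Lemma 9 (tree form, PROVED)**: for every `n ≥ 1` there is a Hardy–Ramanujan integer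
`m ≤ n` with `σ(n)/n ≤ σ(m)/m`. (Printed: the maximum of `σ(n)/n` over the integers with a given
exponent pattern is attained at the Hardy–Ramanujan one, which is the least of them.)
[cite: CLMS2007, Lemma 9] -/
theorem exists_hardyRamanujan_le (n : ℕ) (hn : n ≠ 0) :
    ∃ m : ℕ, m ≠ 0 ∧ m ≤ n ∧ IsHardyRamanujan m ∧ σ 1 n * m ≤ σ 1 m * n := by
  induction n using Nat.strong_induction_on with
  | _ n ih =>
    by_cases hH : IsHardyRamanujan n
    · exact ⟨n, hn, le_rfl, hH, le_rfl⟩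
    · -- a violating pair of primes `p < q`
      have hex : ∃ p q : ℕ, p.Prime ∧ q.Prime ∧ p < q ∧ n.factorization p < n.factorization q := by
        by_contra hne
        push Not at hne
        exact hH ⟨hn, fun p q hp hq hpq => hne p q hp hq hpq⟩
      obtain ⟨p, q, hp, hq, hpq, hlt⟩ := hex
      have hpq' : p ≠ q := hpq.ne
      set e := n.factorization p with he
      set f := n.factorization q with hf
      -- decompose `n = p^e · (q^f · r)`
      set n₁ := ordCompl[p] n with hn₁
      have hn₁f : n₁.factorization q = f := by
        rw [hn₁, Nat.factorization_ordCompl, Finsupp.erase_ne hpq'.symm]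
      set r := ordCompl[q] n₁ with hr
      have hn₁0 : n₁ ≠ 0 := by
        intro h0
        have := Nat.ordProj_mul_ordCompl_eq_self n p
        rw [← hn₁, h0, mul_zero] at this
        exact hn this.symm
      have hr0 : r ≠ 0 := by
        intro h0
        have := Nat.ordProj_mul_ordCompl_eq_self n₁ q
        rw [← hr, h0, mul_zero] at this
        exact hn₁0 this.symm
      have hn_eq : n = p ^ e * (q ^ f * r) := by
        have h1 := Nat.ordProj_mul_ordCompl_eq_self n p
        have h2 := Nat.ordProj_mul_ordCompl_eq_self n₁ q
        rw [← hn₁] at h1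
        rw [← hr, hn₁f] at h2
        rw [← h1, ← h2]
      have hpr : ¬ p ∣ r := fun hd =>
        Nat.not_dvd_ordCompl hp hn (hd.trans (hr ▸ Nat.ordCompl_dvd n₁ q))
      have hqr : ¬ q ∣ r := hr ▸ Nat.not_dvd_ordCompl hq hn₁0
      -- the exchanged number
      set n' := p ^ (e + 1) * (q ^ (f - 1) * r) with hn'
      have hlt' : n' < n := by
        rw [hn_eq, hn']
        obtain ⟨f', hf'⟩ : ∃ f', f = f' + 1 := ⟨f - 1, by omega⟩
        rw [hf', Nat.add_sub_cancel, pow_succ, pow_succ]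
        have h0 : 0 < p ^ e * q ^ f' * r := by
          have := hp.pos; have := hq.pos; positivity
        nlinarith
      have hn'0 : n' ≠ 0 := by
        rw [hn']; have := hp.pos; have := hq.pos; positivity
      have hex' := sigma_exchange_lt hp hq hpq hpr hqr hr0 hlt
      rw [← hn_eq, ← hn'] at hex'
      obtain ⟨m, hm0, hmle, hmH, hmσ⟩ := ih n' hlt' hn'0
      refine ⟨m, hm0, hmle.trans hlt'.le, hmH, ?_⟩
      -- `σ(n) n' < σ(n') n` and `σ(n') m ≤ σ(m) n'` give `σ(n) m ≤ σ(m) n`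
      have hn'pos : 0 < n' := Nat.pos_of_ne_zero hn'0
      have key : σ 1 n * m * n' ≤ σ 1 m * n * n' := by
        calc σ 1 n * m * n' = (σ 1 n * n') * m := by ring
          _ ≤ (σ 1 n' * n) * m := Nat.mul_le_mul_right _ hex'.le
          _ = (σ 1 n' * m) * n := by ring
          _ ≤ (σ 1 m * n') * n := Nat.mul_le_mul_right _ hmσ
          _ = σ 1 m * n * n' := by ring
      exact Nat.le_of_mul_le_mul_right key hn'pos

/-! ### `σ(m)/m ≤ 4.2518` for `m ≤ 5040` (kernel certificate) -/

/-- Kernel evaluation of the tree's Robin certificate on `[1, 5041)` with constant `42518/10⁴`: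
`σ(m) · 10⁴ ≤ 42518 · m` for `1 ≤ m ≤ 5040` (the maximum of `σ(m)/m` there is `σ(5040)/5040 = 3.838…`).
[folklore] -/
private theorem checkRange_one_5040 : RobinCheck.checkRange 42518 10000 1 5040 = true := by
  decide +kernel

/-- `σ(m) · 10⁴ ≤ 42518 · m` for `1 ≤ m ≤ 5040`. [folklore] -/
private theorem sigma_le_of_le_5040 {m : ℕ} (hm0 : m ≠ 0) (hm : m ≤ 5040) :
    (σ 1 m : ℝ) * (10000 : ℕ) ≤ (42518 : ℕ) * m :=
  RobinCheck.check_sound hm0 (by omega)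
    (RobinCheck.checkRange_sound checkRange_one_5040 m (Nat.pos_of_ne_zero hm0) (by omega))

/-! ### CLMS Prop. 1 and the equivalence -/

/-- **CLMS 2007, §5 Prop. 1 (PROVED, RH-free)**: "If Robin's inequality holds for all Hardy–Ramanujan
integers `5041 ≤ n ≤ x`, then it holds for all integers `5041 ≤ n ≤ x`."
[cite: CLMS2007, Prop. 1 (§5); Broughan2017Arithmetic, §8.2] -/
theorem CLMS2007_prop1 {x : ℕ}
    (h : ∀ n : ℕ, IsHardyRamanujan n → 5040 < n → n ≤ x → robinInequality n) {n : ℕ}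
    (hn : 5040 < n) (hx : n ≤ x) : robinInequality n := by
  obtain ⟨m, hm0, hmn, hmH, hσ⟩ := exists_hardyRamanujan_le n (by omega)
  have hnR : (0 : ℝ) < n := by exact_mod_cast (show 0 < n by omega)
  have hmR : (0 : ℝ) < m := by exact_mod_cast Nat.pos_of_ne_zero hm0
  have hσR : (σ 1 n : ℝ) * m ≤ (σ 1 m : ℝ) * n := by exact_mod_cast hσ
  rcases lt_or_ge 5040 m with hm | hm
  · -- Robin at the Hardy–Ramanujan `m`, and `log log m ≤ log log n`
    have hRm := h m hmH hm (hmn.trans hx)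
    unfold robinInequality at hRm ⊢
    have hmn' : (m : ℝ) ≤ n := by exact_mod_cast hmn
    have hm1 : (1 : ℝ) < m := by exact_mod_cast (show 1 < m by omega)
    have hlogm : 0 < log (m : ℝ) := Real.log_pos hm1
    have hll : log (log (m : ℝ)) ≤ log (log (n : ℝ)) :=
      Real.log_le_log hlogm (Real.log_le_log (by linarith) hmn')
    have hllpos : 0 < log (log (m : ℝ)) := by
      refine Real.log_pos ?_
      rw [Real.lt_log_iff_exp_lt (by linarith)]
      have := Real.exp_one_lt_d9
      have h5040 : (5040 : ℝ) < m := by exact_mod_cast hm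
      linarith
    have heγ : 0 < exp eulerMascheroniConstant := exp_pos _
    -- `σ(n) ≤ σ(m) n / m < e^γ n log log m ≤ e^γ n log log n`
    have h1 : (σ 1 n : ℝ) * m < exp eulerMascheroniConstant * m * log (log (m : ℝ)) * n := by
      nlinarith
    have h2 : (σ 1 n : ℝ) < exp eulerMascheroniConstant * n * log (log (m : ℝ)) := by
      have := lt_of_mul_lt_mul_right (a := (m : ℝ))
        (show (σ 1 n : ℝ) * m < exp eulerMascheroniConstant * n * log (log (m : ℝ)) * m by
          linarith) hmR.le
      exact this
    calc (σ 1 n : ℝ) < exp eulerMascheroniConstant * n * log (log (m : ℝ)) := h2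
      _ ≤ exp eulerMascheroniConstant * n * log (log (n : ℝ)) := by gcongr
  · rcases le_or_gt n 55440 with h5 | h5
    · exact robinInequality_le_55440 n hn h5
    · -- `σ(n)/n ≤ σ(m)/m ≤ 4.2518 < 1.7802 · log log 54000`
      have hchk := sigma_le_of_le_5040 hm0 hm
      have hσn : (σ 1 n : ℝ) * (10000 : ℕ) ≤ (42518 : ℕ) * n := by
        have h1 : (σ 1 n : ℝ) * (10000 : ℕ) * m ≤ (42518 : ℕ) * n * m := by
          calc (σ 1 n : ℝ) * (10000 : ℕ) * m = ((σ 1 n : ℝ) * m) * (10000 : ℕ) := by ring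
            _ ≤ ((σ 1 m : ℝ) * n) * (10000 : ℕ) := by gcongr
            _ = ((σ 1 m : ℝ) * (10000 : ℕ)) * n := by ring
            _ ≤ ((42518 : ℕ) * m) * n := by gcongr
            _ = (42518 : ℕ) * n * m := by ring
        exact le_of_mul_le_mul_right h1 hmR
      exact RobinCheck.robinInequality_of_bound (b := 54000) (L := 2.3884) (by norm_num)
        (by exact_mod_cast (show 54000 ≤ n by omega)) RobinCheck.loglog_54000 (by norm_num)
        (by norm_num) (by norm_num) hσn

/-- **RH `⟺` Robin's inequality on the Hardy–Ramanujan integers `> 5040`**, from Robin's criterion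
(kernel-grade form). [cite: CLMS2007, Prop. 1 (§5); Robin1984, Thm. 1; Broughan2017Arithmetic, §8.2] -/
theorem riemannHypothesis_iff_robin_hardyRamanujan_of (hR : robin_iff) :
    RiemannHypothesis ↔ ∀ n : ℕ, IsHardyRamanujan n → 5040 < n → robinInequality n := by
  rw [robin_iff_iff] at hR
  rw [hR]
  refine ⟨fun h n _ hn => h n hn, fun h n hn => ?_⟩
  exact CLMS2007_prop1 (x := n) (fun m hm hm5 _ => h m hm hm5) hn le_rfl

/-- **RH `⟺` Robin's inequality `σ(n) < e^γ n log log n` holds for every Hardy–Ramanujan integer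
`n > 5040`** (unconditional, via `robin_iff_holds`).
[cite: CLMS2007, Prop. 1 (§5); Robin1984, Thm. 1; Broughan2017Arithmetic, §8.2] -/
theorem riemannHypothesis_iff_robin_hardyRamanujan :
    RiemannHypothesis ↔ ∀ n : ℕ, IsHardyRamanujan n → 5040 < n → robinInequality n :=
  riemannHypothesis_iff_robin_hardyRamanujan_of robin_iff_holds

end Literature.NumberTheory.LFunctions

end
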